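import Summits.AtomisticToContinuum.Crystallization.Theorems.ChartedZeroExcessLayeredLatticeLiouvilleZZZYRCXK

/-!
# ChartedZeroExcessLayeredLatticeLiouville · ZZZYRCXRK — THE θ⁰ OUT-OF-WINDOW KERNEL PROGRAM (letters enumerated LOCALLY; «exact sup» (b))
(decomp-a2c hand-1 g55, STAGED for g56 — not a tree file until its soundness (RCXRL) is typed against it; critic r1864 (A)(4), r1867 (R4),
r1869 (C) decision (b) «max_σ per incidence, key-wise»; memo RCXR-DESIGN-g55 ADDENDUM A)

Window type: letters `win : List ℕ` on the shifted layers `[wlo, whi]` (`wlo = 600 + c − H₀`, `whi = 600 + c + H₀`, base = window centre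
`c`, shifted base layer `amX = 600 + c`).  An OUT-PAIR `(X, Y)` has `|m_Y − c| > H₀`; the letters of the out-of-window layers its path touches are
unknown (`∈ {0,1,2}`).  Per incidence `i` (piece `a → b`) the coefficients see letters at THREE layers only: `m_Y` (through the chord's `u9`), `m_a`,
`m_b` (through `p9`, `d18`).  The kernel therefore enumerates `(rY, ra, rb) ∈ {0,1,2}³` LOCALLY with the lookup priority window > `m_Y` > `m_a` >
`m_b` (coinciding layers stay consistent), REJECTS a piece unless `0 < p9 ≤ P9max` for every `(ra, rb)` (the actual letters may be any), treats a
trial `rY` whose `u9` is off the window `(lo, hi]` as contributing ZERO, rejects a chord with no `rY` in range, and bumps ONE pair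
`(max cR, max cN)` per incidence at the θ_in key `(m_a [shifted], Δγ₀, Δγ₁, Δm)`.  Data format = v8 (plain code lists), no σ-copies.
§1 letter lookup `regO`; §2 per-`rY` chord contexts `octx`; §3 `pieceEvalO`/`pieceO` (one trial / all trials of a piece), `keyO`, the hot loop
`walkPO`; §4 `addChordO`, `slabAccO`; §5 the out-count `countWinsO`
(index sites with `H₀ < |Δm|`, counted per Δm-block by the ∃-letter window test).  Mathlib-light (imports RCXK); 0 sorry; PROGRAM ONLY.
-/

namespace Summit.AtomisticToContinuum.Crystallization.Theorems.ChartedZeroExcessLayeredLatticeLiouville.ThetaKernel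

/-! ## §1 the letter lookup with local trial letters -/

/-- is the shifted layer `am` inside the letter window `[wlo, whi]`? -/
def inWin (wlo whi am : ℕ) : Bool := Nat.ble wlo am && Nat.ble am whi

/-- ★ letter at shifted layer `am`: the window letter if `am ∈ [wlo, whi]`, else the trial letter of the FIRST matching special layer in the
priority order `amY` (far site) > `amA` (piece start) > otherwise `rb` (piece end). -/
def regO (win : List ℕ) (wlo whi amY rY amA ra rb am : ℕ) : ℕ :=
  bif inWin wlo whi am then win.getD (am - wlo) 0 else bif Nat.beq am amY then rY else bif Nat.beq am amA then ra else rb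

/-- the trial letters to loop over for a layer: the single window letter (as a dummy `0`, ignored by `regO`) if in window or equal to a
higher-priority layer, else all of `{0,1,2}`. -/
def trials (free : Bool) : List ℕ := bif free then [0, 1, 2] else [0]

/-! ## §2 per-`rY` chord contexts -/

/-- the per-`rY` constants of one chord: trial far letter, sign-split chord form `(f0p,f0n,f1p,f1n,gp,gn,Cp,Cn)`, `Bn = 4u9⁵`, `U4n = 4u9`,
`cR = ⌈An/u9⁴⌉`. -/
structure OCtx where
  /-- trial letter at the far layer -/
  rY : ℕ
  /-- positive part of `f₀ = 2e₀ + e₁` -/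
  f0p : ℕ
  /-- negative part of `f₀` -/
  f0n : ℕ
  /-- positive part of `f₁ = 2e₁ + e₀` -/
  f1p : ℕ
  /-- negative part of `f₁` -/
  f1n : ℕ
  /-- positive part of `g = 12e₂` -/
  gp : ℕ
  /-- negative part of `g` -/
  gn : ℕ
  /-- positive part of the offset constant `C` -/
  Cp : ℕ
  /-- negative part of `C` -/
  Cn : ℕ
  /-- `4·u9⁵` -/
  Bn : ℕ
  /-- `4·u9` -/
  U4n : ℕ
  /-- `⌈An/u9⁴⌉` -/
  cR : ℕ

/-- the context of the chord `X = (600, 600, amX) → Y = (y0, y1, ym)` (shifted) for the trial far letter `rY`, or `none` if its `u9` is off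
the window `(lo, hi]` (that trial contributes zero).  The stored far letter is the LOOKED-UP one (`win` letter if `ym` is in the window, else
`rY`), so that the context of an admissible assignment `ρ` is literally `ctxOf ρ …` (RCXRL). -/
def octx (win : List ℕ) (wlo whi amX AE n y0 y1 ym : ℕ) (lo hi : ℤ) (rY : ℕ) : Option OCtx :=
  let rX := regO win wlo whi ym rY ym rY rY amX
  let rYv := regO win wlo whi ym rY ym rY rY ym
  let dr : ℤ := (rYv : ℤ) - (rX : ℤ)
  let e0 : ℤ := 3 * ((y0 : ℤ) - 600) + dr
  let e1 : ℤ := 3 * ((y1 : ℤ) - 600) + dr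
  let em : ℤ := (ym : ℤ) - (amX : ℤ)
  let u9 := e0 * e0 + e0 * e1 + e1 * e1 + 6 * em * em
  bif ((u9 ≤ lo : Bool) || (hi < u9 : Bool)) then none else
  let u9n := u9.toNat
  let An : ℕ := AE * n
  let u2 := u9n * u9n
  let u4 := u2 * u2
  let f0 := 2 * e0 + e1
  let f1 := 2 * e1 + e0
  let g := 12 * em
  let C := 3603 * (f0 + f1) + 1201 * g
  some ⟨rYv, f0.toNat, (-f0).toNat, f1.toNat, (-f1).toNat, g.toNat, (-g).toNat, C.toNat, (-C).toNat, 4 * u4 * u9n, 4 * u9n,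
    (An + u4 - 1) / u4⟩

/-! ## §3 the hot loop with the local letter enumeration -/

/-- fold: `none` if ANY entry is `none`, else `some` of the maximum (`some 0` on the empty list). -/
def maxAll : List (Option ℕ) → Option ℕ
  | [] => some 0
  | none :: _ => none
  | some v :: rest => match maxAll rest with
    | none => none
    | some m => some (Nat.max v m)

/-- the largest `cR` among the contexts (trial far letters in range). -/
def cRmax (ctxs : List OCtx) : ℕ := (ctxs.map (·.cR)).foldl Nat.max 0

/-- ONE TRIAL of one piece: from `(a0, a1, am)` to the decoded `(b0, b1, bm)` of code `c`, context `κ` (trial far letter), trial letters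
`(ra, rb)`: `none` unless `c < 1201³ ∧ 0 < p9 ≤ P9max`; else the dyadic N coefficient `⌈An·(4u9·p9 − d18²)/(4u9⁵·p9)⌉`. -/
def pieceEvalO (win : List ℕ) (wlo whi amY P9 An : ℕ) (κ : OCtx) (a0 a1 am b0 b1 bm c ra rb : ℕ) : Option ℕ :=
  let rA := regO win wlo whi amY κ.rY am ra rb am
  let rB := regO win wlo whi amY κ.rY am ra rb bm
  let x0 := 3 * (b0 + 1201 - a0) + rB - rA
  let x1 := 3 * (b1 + 1201 - a1) + rB - rA
  let xm := bm + 1201 - am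
  let p9n := x0 * x0 + x0 * x1 + x1 * x1 + 38944827 + 6 * (xm * xm) + 8654406 - (10809 * (x0 + x1) + 14412 * xm)
  bif (!(Nat.blt c 1732323601) || Nat.beq p9n 0 || Nat.blt P9 p9n) then none else
  let P := κ.f0p * x0 + κ.f1p * x1 + κ.gp * xm + κ.Cn
  let Q := κ.f0n * x0 + κ.f1n * x1 + κ.gn * xm + κ.Cp
  let da := (P - Q) + (Q - P)
  let den := κ.Bn * p9n
  some ((An * (κ.U4n * p9n - da * da) + den - 1) / den)

/-- ALL TRIALS of one piece: every context × every trial letter of the FREE endpoint layers (free = out of window and not a higher-priority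
layer); `none` if any trial is invalid, else the maximal N coefficient. -/
def pieceO (win : List ℕ) (wlo whi amY P9 An : ℕ) (ctxs : List OCtx) (a0 a1 am c : ℕ) : Option ℕ :=
  let b0 := c / 1442401
  let b1 := c / 1201 % 1201
  let bm := c % 1201
  let freeA := !(inWin wlo whi am) && !(Nat.beq am amY)
  let freeB := !(inWin wlo whi bm) && !(Nat.beq bm amY) && !(Nat.beq bm am)
  maxAll (ctxs.flatMap fun κ => (trials freeA).flatMap fun ra => (trials freeB).map fun rb =>
    pieceEvalO win wlo whi amY P9 An κ a0 a1 am b0 b1 bm c ra rb)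

/-- the key code of a piece in WINDOW currency: `(shifted start layer, Δγ₀ + 600, Δγ₁ + 600, Δm + 600)` (no residue reduction). -/
def keyO (a0 a1 am b0 b1 bm : ℕ) : ℕ := ((am * 1201 + (b0 + 600 - a0)) * 1201 + (b1 + 600 - a1)) * 1201 + (bm + 600 - am)

/-- ★ THE OUT HOT LOOP: per piece, all trials (`pieceO`); `none` if any trial is invalid or the key is absent; else bump ONE pair
`(cRmax, max cN)` at the window key and continue from the decoded site. -/
noncomputable def walkPO (win : List ℕ) (wlo whi amY P9 An : ℕ) (ctxs : List OCtx) :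
    ℕ → ℕ → ℕ → List ℕ → PT → Option PT
  | _, _, _, [], t => some t
  | a0, a1, am, c :: rest, t =>
      match pieceO win wlo whi amY P9 An ctxs a0 a1 am c with
      | none => none
      | some cN =>
        match t.bump (keyO a0 a1 am (c / 1442401) (c / 1201 % 1201) (c % 1201)) (cRmax ctxs) cN with
        | none => none
        | some t' => walkPO win wlo whi amY P9 An ctxs (c / 1442401) (c / 1201 % 1201) (c % 1201) rest t'

/-! ## §4 one chord and the slab -/

/-- ★ ONE OUT-CHORD from the shifted base site `(600, 600, amX)`: contexts for the trial far letters in range (REJECT if none), then the walk.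
Key layer component = the shifted start layer `am` itself (window currency: no residue reduction). -/
noncomputable def addChordO (win : List ℕ) (wlo whi amX P9 AE : ℕ) (lo hi : ℤ) (c : List ℕ) (t : PT) : Option PT :=
  let y := lastD c 0
  let y0 := y / 1442401
  let y1 := y / 1201 % 1201
  let ym := y % 1201
  let ctxs := (trials (!(inWin wlo whi ym))).filterMap (octx win wlo whi amX AE c.length y0 y1 ym lo hi)
  bif ctxs.isEmpty then none else
  walkPO win wlo whi ym P9 (AE * c.length) ctxs 600 600 amX c t

/-- ★ THE OUT-SLAB PROGRAM: fold all chords into the zero-payload key tree (`none` = some chord/piece invalid for some trial letters). -/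
noncomputable def slabAccO (win : List ℕ) (wlo whi amX P9 E : ℕ) (lo hi : ℤ) (t0 : PT) (cs : List (List ℕ)) :
    Option (List (ℕ × ℕ × ℕ)) :=
  let AE := 2 ^ E * 45927
  (cs.foldl (fun acc c => match acc with | none => none | some t => addChordO win wlo whi amX P9 AE lo hi c t) (some t0)).map PT.toList

/-! ## §5 the out-count (completeness of a Δm-block by the ∃-letter window test) -/

/-- `n9` of the far index site with box offsets `(a, b)` (`γ = a − GB, b − GB`) at shifted layer `ym` from the shifted base `amX`, for the
trial far letter `rY` (window letters by `regO`), by the offset identity of `countWins`. -/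
def u9O (win : List ℕ) (wlo whi amX GB : ℕ) (a b ym rY : ℕ) : ℕ :=
  let ra := regO win wlo whi ym rY ym rY rY amX
  let rb := regO win wlo whi ym rY ym rY rY ym
  let K := 3 * GB + 3
  let x0 := 3 * a + 3 + rb - ra
  let x1 := 3 * b + 3 + rb - ra
  let cm := ym + 1201 - amX
  x0 * x0 + x0 * x1 + x1 * x1 + 3 * K * K + 6 * (cm * cm) + 8654406 - (3 * K * (x0 + x1) + 14412 * cm)

/-- does SOME trial far letter put the site in the window `(lo, hi]` (naturals)? -/
def someInWindow (win : List ℕ) (wlo whi amX GB lo hi a b ym : ℕ) : Bool :=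
  (trials (!(inWin wlo whi ym))).any fun rY => let u := u9O win wlo whi amX GB a b ym rY; Nat.blt lo u && Nat.ble u hi

/-- ★ THE OUT-COUNT of ONE Δm-block: the number of index sites `(γ₀, γ₁)` of the box `|γ| ≤ GB` at the shifted far layer `ym` for which
SOME trial far letter puts `n9` in `(lo, hi]` — the pigeonhole partner of an out-slab holding exactly the chords of that layer. -/
def countWinsO (win : List ℕ) (wlo whi amX GB lo hi ym : ℕ) : ℕ :=
  (List.range (2 * GB + 1)).foldl (fun n a =>
    (List.range (2 * GB + 1)).foldl (fun n b => bif someInWindow win wlo whi amX GB lo hi a b ym then n + 1 else n) n) 0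

end Summit.AtomisticToContinuum.Crystallization.Theorems.ChartedZeroExcessLayeredLatticeLiouville.ThetaKernel
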